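import Summits.BirchSwinnertonDyer.Rank1Residual.Additive.SignedTwistKummerDictionary
import HarnessLib

/-!
# (P5-4a) The SELMER DICTIONARY of the signed-`η` twist at a finite layer:
# `c ∈ Sel^{−,str}(W/ℚ_n) ↔ Θ_n c ∈ Sel⁻(V/K₀ℚ_n)` (`cells/n1011/skel/T-O7ss-P5.md` §2 (D2))
(cell `b2b-bsdres`, team n1011, seat n1011-p17 GEN 7; row T-O7ss-P13 follow-up (P5), file P5-4a;
designs (A)(B) APPROVED by referee-1 GEN 22)

HONEST FRAMING (cell `b2b-bsdres`, run/shared/lean/b2b/bsd-rank1-residual/, verbatim in every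
file): the goal of the cell is to DELETE the COMBINATION-SHAPED residual classes of the
Birch–Swinnerton-Dyer formula for ALL analytic-rank `≤ 1` elliptic curves over `ℚ` — "full BSD
formula for every rank `≤ 1` curve in class `C`" assembled STRICTLY from published theorems — so
that the rank-`≤ 1` remainder becomes exactly the CONSTRUCTION-SHAPED classes, which are TYPED
(missing-input `Prop`s), NOT attempted. This is not "finishing BSD". Research route on
O7-ss ∩ (G)∧ss ∩ e = 2 (OPEN) / X4 CONSTRUCTION-SHAPED; nothing here is booked; no label moves.
TOOL THEOREMS ONLY: no definition, no named Literature fact, no `sorry`; axioms standard.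


Binders: `hD` = (D0) at `closureEmb E`; `hκ₀` (RESHAPE, P5-2a); `hcop : p ∤ [Γ_ℚ : Gal(ℚ̄/K₀)]`;
`[(galRange K₀).Normal]`; `hη`. No `p ≠ 2`, no `IsElliptic`.

## What is proved
* `mem_localKerOver_iff_h1Transport` (the classical local condition at ANY `ℚ`-field transports
  under `Θ_*`: the tree's `mem_resKer_iff_h1Equiv_mem` with the local square as intertwiner),
  `mem_selmerGroupOver_iff_h1Transport` (`Sel_{p^∞}(W/L) ≅ Sel_{p^∞}(V/L)` under `Θ_*` for normal
  `Gal(ℚ̄/L) ≤ Gal(ℚ̄/K₀)`; signs `η(σ)` invisible to membership);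
* `relIndex_tower_layer_dvd`, `h1TransportLayer_conjH1` (`Θ_n ∘ conj_σ = η(σ)·conj_σ ∘ Θ_n`);
* **`mem_strictSignedSelmerLayer_iff_h1TransportLayer`** ((D2) at layer `n`): classical part by
  restriction + additive-p2's prime-to-`p` descent `relIndex_nsmul_mem_selmerGroupOver_of_resOfLe_mem_rel`
  (`[K₀ℚ_n : ℚ_n] ∣ [Γ_ℚ : Gal(ℚ̄/K₀)]` prime to `p`, classes `p`-primary), signed part at `p` by the
  Kummer dictionary (D4c) at every conjugate `σ`.

References: S. Kobayashi, Invent. Math. 152 (2003) Def. 1.1, Def. 2.1 [Kobayashi2003];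
T. & V. Dokchitser, Ann. of Math. 172 (2010) Lemma 4.14 [DokchitserDokchitserAnnals2010];
R. Greenberg, LNM 1716 (1999) §5 p. 143 [GreenbergLNM1716].
-/

noncomputable section

open scoped Classical

open WeierstrassCurve Field

namespace Summit.BirchSwinnertonDyer.Rank1Residual.Additive.SignedTwist

open Literature.NumberTheory.EllipticCurves Literature.NumberTheory.GaloisRepresentations
  Literature.NumberTheory.EllipticCurves.Kobayashi2003
  Summit.BirchSwinnertonDyer.Rank1Residual.AdditivePotMult

section SelmerClassical

open ZpExtension

variable (W : WeierstrassCurve ℚ) (K₀ : Type) [Field K₀] [NumberField K₀] {θ : K₀} {c : ℚ}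
  (hθ : θ ∉ Set.range (algebraMap ℚ K₀)) (hc : θ ^ 2 = algebraMap ℚ K₀ c)
  (p : ℕ) [Fact p.Prime]
  {V : WeierstrassCurve ℚ} {C : VariableChange ℚ} (hCV : C • W.quadraticTwist c = V)
  (η : absoluteGaloisGroup ℚ →* ℤˣ)
  (hη : ∀ σ : absoluteGaloisGroup ℚ, η σ = 1 ↔ σ • rootInClosure K₀ θ = rootInClosure K₀ θ)

omit [Fact p.Prime] in
/-- **The classical local condition transports under `Θ_*`** at every `ℚ`-field `E` (chosen
embedding): `c` dies in `H¹(H_E, W(ℚ̄_E))` iff `Θ_* c` dies in `H¹(H_E, V(ℚ̄_E))` — the local square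
`pointsMap_geomTransport` intertwines the two restriction pairs and `Ψ` is `H_E`-equivariant
(`mem_resKer_iff_h1Equiv_mem`). [cite: Dokchitser2013ParityNotes, §4] -/
theorem mem_localKerOver_iff_h1Transport (H : Subgroup (absoluteGaloisGroup ℚ))
    (hH : H ≤ galRange (K := ℚ) K₀) (E : Type) [Field E] [Algebra ℚ E] (x : W.subgroupH1 p H) :
    x ∈ W.localKerOver p H E ↔ h1Transport W K₀ hθ hc p hCV H hH x ∈ V.localKerOver p H E :=
  mem_resKer_iff_h1Equiv_mem (resGalSubgroupOfEmb H (closureEmb (K := ℚ) E))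
    ((pointsMapOfEmb W (closureEmb (K := ℚ) E)).comp (W.geomPrimaryTorsion p).subtype) _
    ((pointsMapOfEmb V (closureEmb (K := ℚ) E)).comp (V.geomPrimaryTorsion p).subtype) _
    (geomTransport W K₀ hθ hc p hCV) (geomTransport_smul_of_le W K₀ hθ hc p hCV hH)
    (localTransport W K₀ hθ hc hCV E (closureEmb (K := ℚ) E))
    (fun τ P ↦ localTransport_smul_of_mem W K₀ hθ hc hCV E (closureEmb (K := ℚ) E) hH τ P)
    (fun m ↦ pointsMap_geomTransport W K₀ hθ hc p hCV E m) x

omit [Fact p.Prime] in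
include hη in
/-- **`Sel_{p^∞}(W/L) ≅ Sel_{p^∞}(V/L)` under `Θ_*` for every normal `H = Gal(ℚ̄/L) ≤ Gal(ℚ̄/K₀)`**
(all places of `ℚ`, all conjugates; the conjugation rule holds up to the sign `η(σ)`, which
membership does not see). [cite: Dokchitser2013ParityNotes, §4] -/
theorem mem_selmerGroupOver_iff_h1Transport (H : Subgroup (absoluteGaloisGroup ℚ)) [H.Normal]
    (hH : H ≤ galRange (K := ℚ) K₀) (x : W.subgroupH1 p H) :
    x ∈ W.selmerGroupOver p H ↔ h1Transport W K₀ hθ hc p hCV H hH x ∈ V.selmerGroupOver p H := by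
  have key : ∀ (σ : absoluteGaloisGroup ℚ) (E : Type) [Field E] [Algebra ℚ E],
      W.conjH1 p H σ x ∈ W.localKerOver p H E ↔
        V.conjH1 p H σ (h1Transport W K₀ hθ hc p hCV H hH x) ∈ V.localKerOver p H E := by
    intro σ E _ _
    rw [mem_localKerOver_iff_h1Transport W K₀ hθ hc p hCV H hH E, h1Transport_conjH1 W K₀ hθ hc p hCV η hη]
    rcases Int.units_eq_one_or (η σ) with h | h
    · rw [h, Units.val_one, one_zsmul]
    · rw [h, Units.val_neg, Units.val_one, neg_one_zsmul, neg_mem_iff]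
  rw [mem_selmerGroupOver_iff, mem_selmerGroupOver_iff]
  exact ⟨fun h ↦ ⟨fun v σ ↦ (key σ _).mp (h.1 v σ), fun w σ ↦ (key σ _).mp (h.2 w σ)⟩,
    fun h ↦ ⟨fun v σ ↦ (key σ _).mpr (h.1 v σ), fun w σ ↦ (key σ _).mpr (h.2 w σ)⟩⟩

end SelmerClassical

section SelmerLayer

open ZpExtension

variable (W : WeierstrassCurve ℚ) (K₀ : Type) [Field K₀] [NumberField K₀] {θ : K₀} {c : ℚ}
  (hθ : θ ∉ Set.range (algebraMap ℚ K₀)) (hc : θ ^ 2 = algebraMap ℚ K₀ c)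
  (p : ℕ) [Fact p.Prime] (κ : ZpExtension ℚ p)
  {V : WeierstrassCurve ℚ} {C : VariableChange ℚ} (hCV : C • W.quadraticTwist c = V)
  (E : Type) [Field E] [Algebra ℚ E]
  (η : absoluteGaloisGroup ℚ →* ℤˣ)
  (hη : ∀ σ : absoluteGaloisGroup ℚ, η σ = 1 ↔ σ • rootInClosure K₀ θ = rootInClosure K₀ θ)

/-- `[Gal(ℚ̄/ℚ_n) : Gal(ℚ̄/K₀ℚ_n)] ∣ [Γ_ℚ : Gal(ℚ̄/K₀)]`. [folklore] -/
theorem relIndex_tower_layer_dvd [(galRange (K := ℚ) K₀).Normal] (n : ℕ) :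
    (towerSubgroup κ K₀ n).relIndex (κ.layerSubgroup n) ∣ (galRange (K := ℚ) K₀).index := by
  rw [show towerSubgroup κ K₀ n = κ.layerSubgroup n ⊓ galRange (K := ℚ) K₀ from rfl,
    Subgroup.inf_relIndex_left]
  exact Subgroup.relIndex_dvd_index_of_normal _ _

include hη in
/-- `Θ_n ∘ conj_σ = η(σ) · conj_σ ∘ Θ_n`. [cite: Dokchitser2013ParityNotes, §4] -/
theorem h1TransportLayer_conjH1 [(galRange (K := ℚ) K₀).Normal] (n : ℕ) (σ : absoluteGaloisGroup ℚ)
    (x : W.subgroupH1 p (κ.layerSubgroup n)) :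
    h1TransportLayer W K₀ hθ hc p κ hCV n (W.conjH1 p (κ.layerSubgroup n) σ x) =
      ((η σ : ℤˣ) : ℤ) • V.conjH1 p (towerSubgroup κ K₀ n) σ (h1TransportLayer W K₀ hθ hc p κ hCV n x) := by
  have h1 := towerSubgroup_le_layerSubgroup K₀ p κ n
  rw [AddMonoidHom.comp_apply, AddMonoidHom.comp_apply, ← AddMonoidHom.comp_apply (W.resOfLe p h1),
    show (W.resOfLe p h1).comp (W.conjH1 p (κ.layerSubgroup n) σ) =
      (W.conjH1 p (towerSubgroup κ K₀ n) σ).comp (W.resOfLe p h1) from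
      resOfLe_comp_conjH1_holds (M := W.geomPrimaryTorsion p) h1 σ,
    AddMonoidHom.comp_apply, AddMonoidHom.coe_coe, h1Transport_conjH1 W K₀ hθ hc p hCV η hη]

include hη in
/-- **(D2, finite layer) THE SELMER DICTIONARY at layer `n`**: `c ∈ Sel^{−,str}(W/ℚ_n)` (p17 F2a)
iff `Θ_n c ∈ Sel⁻(V/K₀ℚ_n)` (cc-typer-6, Kobayashi Def. 2.1 verbatim). Classical part: restriction +
prime-to-`p` descent (additive-p2's `relIndex_nsmul_mem_selmerGroupOver_of_resOfLe_mem_rel`,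
`[K₀ℚ_n : ℚ_n] ∣ [K₀ : ℚ]` prime to `p`) + `mem_selmerGroupOver_iff_h1Transport`; at `p`: the Kummer
dictionary (D4c) at every conjugate `σ` (signs invisible to membership).
[cite: Kobayashi2003, Def. 1.1, Def. 2.1 (p. 5)] -/
theorem mem_strictSignedSelmerLayer_iff_h1TransportLayer [(galRange (K := ℚ) K₀).Normal]
    (hD : ∀ g : absoluteGaloisGroup ℚ, ∃ τ : absoluteGaloisGroup E,
      (resGalOfEmb (closureEmb (K := ℚ) E) τ)⁻¹ * g ∈ towerTopSubgroup κ K₀)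
    (hκ₀ : ∀ x, ∃ g ∈ galRange (K := ℚ) K₀, κ g = x)
    (hcop : (galRange (K := ℚ) K₀).index.Coprime p) (n : ℕ)
    (x : W.subgroupH1 p (κ.layerSubgroup n)) :
    x ∈ strictSignedSelmerLayer W κ E (-1) n ↔
      h1TransportLayer W K₀ hθ hc p κ hCV n x ∈ towerSignedSelmerLayer V κ K₀ E (-1) n := by
  have h1 := towerSubgroup_le_layerSubgroup K₀ p κ n
  have hclosed : IsClosed ((κ.layerSubgroup n : Subgroup (absoluteGaloisGroup ℚ)) :
      Set (absoluteGaloisGroup ℚ)) :=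
    Subgroup.isClosed_of_isOpen _ (κ.isOpen_layerSubgroup n)
  -- the signs
  have hsign : ∀ (σ : absoluteGaloisGroup ℚ) (S : AddSubgroup (V.subgroupH1 p (towerSubgroup κ K₀ n))),
      h1TransportLayer W K₀ hθ hc p κ hCV n (W.conjH1 p (κ.layerSubgroup n) σ x) ∈ S ↔
        V.conjH1 p (towerSubgroup κ K₀ n) σ (h1TransportLayer W K₀ hθ hc p κ hCV n x) ∈ S := by
    intro σ S
    rw [h1TransportLayer_conjH1 W K₀ hθ hc p κ hCV η hη]
    rcases Int.units_eq_one_or (η σ) with h | h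
    · rw [h, Units.val_one, one_zsmul]
    · rw [h, Units.val_neg, Units.val_one, neg_one_zsmul, neg_mem_iff]
  rw [Additive.mem_strictSignedSelmerLayer_iff, Additive.mem_towerSignedSelmerLayer_iff]
  constructor
  · rintro ⟨hsel, hp⟩
    refine ⟨?_, fun σ ↦ ?_⟩
    · -- classical: restrict, then transport
      rw [AddMonoidHom.comp_apply, AddMonoidHom.coe_coe,
        ← mem_selmerGroupOver_iff_h1Transport W K₀ hθ hc p hCV η hη]
      exact resOfLe_mem_selmerGroupOver W p h1 hsel
    · rw [← hsign,
        ← mem_localKummerOverOfEmb_strictSigned_iff W K₀ hθ hc p κ hCV E η hη hD hκ₀ hcop n]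
      exact hp σ
  · rintro ⟨hsel, hp⟩
    refine ⟨?_, fun σ ↦ ?_⟩
    · -- classical: transport back, then prime-to-`p` descent
      rw [AddMonoidHom.comp_apply, AddMonoidHom.coe_coe,
        ← mem_selmerGroupOver_iff_h1Transport W K₀ hθ hc p hCV η hη] at hsel
      haveI : ((towerSubgroup κ K₀ n).subgroupOf (κ.layerSubgroup n)).FiniteIndex :=
        ⟨fun h0 ↦ Subgroup.FiniteIndex.index_ne_zero (H := galRange (K := ℚ) K₀)
          (Nat.eq_zero_of_zero_dvd ((show (towerSubgroup κ K₀ n).relIndex (κ.layerSubgroup n) = 0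
            from h0) ▸ relIndex_tower_layer_dvd K₀ p κ n))⟩
      have hd := relIndex_nsmul_mem_selmerGroupOver_of_resOfLe_mem_rel W p h1 (isOpen_galRange K₀)
        rfl hsel
      obtain ⟨j, hj⟩ := exists_pow_nsmul_eq_zero_subgroupH1_of_isClosed W p hclosed x
      exact mem_of_coprime_nsmul_mem p _ hj
        (Nat.Coprime.coprime_dvd_left (relIndex_tower_layer_dvd K₀ p κ n) hcop) hd
    · rw [mem_localKummerOverOfEmb_strictSigned_iff W K₀ hθ hc p κ hCV E η hη hD hκ₀ hcop n, hsign]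
      exact hp σ

end SelmerLayer

end Summit.BirchSwinnertonDyer.Rank1Residual.Additive.SignedTwist
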